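import Literature.Algebra.Lie.LefschetzInvariantFormExistence
import HarnessLib

/-!
# The primitive decomposition `M = ⊕ₖ K[e] P_{-k}` of a Lefschetz module as a linear isomorphism; `dim M = Σₖ (k+1) dim P_{-k}` (Looijenga–Lunts 1997, §1)

Topic `Literature/Algebra/Lie` (namespace `Literature.Algebra.Lie`).  Lane `lit-hodgefound` (Track 2 foundations
library), skeleton seat `lit-hodgefound-skel-1` (generation 44), row **A1-132** of
`run/shared/lean/pub/lit-hodgefound/SKELETON.md`, a rider on A1-128 `LefschetzInvariantFormExistence.lean` (§1 there: the
string coordinates `C_{k,i} : M → P_{-k}` of a string reversal and the operator identity `Σ_{k,i} eⁱ C_{k,i} = 1`): the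
PRIMITIVE DECOMPOSITION used throughout Looijenga–Lunts §1 — "`N = ⊕_{k≥0} ℂ[e] P_{-k}(N)`, where
`P_{-k}(N) := Ker(e^{k+1}|N_{-k})`" — packaged as a LINEAR ISOMORPHISM
`M ≃ₗ[K] Π_{k < D} (Fin (k+1) → P_{-k})` (`x ↦ (C_{k,i} x)_{k,i}`, inverse `(p_{k,i}) ↦ Σ eⁱ p_{k,i}`; `D ≥ dim M`), with
the dimension count `dim M = Σ_{k < D} (k + 1) · dim P_{-k}` ("`M ≅ ⊕ₖ V(k)^{m_k}`" numerically: the `𝔰𝔩₂`-type of `M`).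
For `(M, h)` `ℤ`-graded with a Lefschetz operator `e` (A1-88), finite-dimensional over a field of characteristic `0`.
DEFINITIONS WITH BODIES (`HasLefschetzProperty.stringCoords`, `assembleStrings`,
`HasLefschetzProperty.primitiveDecomposition`) and PROVED theorems; no named fact, no `sorry`, no instance, no notation
(D-0026 net debt `0`); no Lie bracket occurs, so no local instance attribute is needed.

## Source, VERBATIM

E. Looijenga, V. A. Lunts, *A Lie algebra attached to a projective variety*, Invent. Math. **129** (1997) 361–412
(held TeX text `paper:arxiv-alg-geom_9604014`): §1 (1.6), proof, p0006 L10–L12: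

> "Consider the primitive decomposition of `N` with respect to `e_a`: `N = ⊕_{k≥0} ℂ[e] P_{-k}(N)`, where
> `P_{-k}(N) := Ker(e_a^{k+1}|N_{-k})`."

and (1.16) p0008 L85: "The `𝔰𝔩(2)`-triple `(e, h, f)` in `𝔤` determines a primitive decomposition of `V`"; (1.14)
p0007 L106–L108: "the isomorphism class of `M` as a representation of this `𝔰𝔩(2)`-copy only depends on `(𝔤, h)`. We call
it the `𝔰𝔩(2)`-type of `M`"; (1.1) p0004 L1–L2 (the Lefschetz property) and (1.15) proof p0008 L29
("`V(n) ≅ K[e]/(e^{n+1})[n]`").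

## Rendering (dictionary)

* "`ℂ[e] P_{-k}`" = `P_{-k} ⊕ eP_{-k} ⊕ ⋯ ⊕ eᵏP_{-k}` (`e^{k+1} P_{-k} = 0`), with `eⁱ : P_{-k} ≅ eⁱP_{-k}` for `i ≤ k`
  (Lefschetz property) — rendered as `Fin (k + 1) → primitiveSpace h e k` (the `i`-th component = the coefficient on
  `eⁱ P_{-k}`); "`⊕_{k≥0}`" = the product over `k : Fin D`, `D ≥ dim M` (`P_{-k} = 0` for `k ≥ dim M`).
* the components of `x` are A1-128's string coordinates `C_{k,i} x` for any string reversal `s` (in particular André's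
  `*_L`, `HasLefschetzProperty.lefschetzInvolution`).

## Contents (all proved)

* §1 `HasLefschetzProperty.stringCoords` (`x ↦ (C_{k,i} x)`), `assembleStrings` (`(p_{k,i}) ↦ Σ eⁱ p_{k,i}`) and their
  unfoldings.
* §2 `assembleStrings_stringCoords` (`Σ eⁱ C_{k,i} x = x`, A1-128 `sum_pow_mul_stringCoord` re-indexed),
  `stringCoords_assembleStrings` (the coordinates of an assembled vector), **`HasLefschetzProperty.primitiveDecomposition`**
  (the `LinearEquiv`), `primitiveDecomposition_apply`, `primitiveDecomposition_symm_apply`.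
* §3 **`finrank_eq_sum_mul_finrank_primitiveSpace`** (`dim M = Σ_{k<D} (k+1) dim P_{-k}`, any `D ≥ dim M`), the case
  `D = dim M`, and `finrank_eq_zero_iff_forall_primitiveSpace` (`M = 0` iff no `V(k)` occurs).

## SCOPE

(a) The decomposition is `K`-linear bookkeeping; its compatibility with `h` (degrees `2i - k`) and `e` (shift in `i`)
is A1-128 `stringCoord_apply_pow_primitive` and is not restated as a module isomorphism with `⊕ V(k) ⊗ P_{-k}`.
(b) Nothing here concerns complex tori or the Hodge conjecture.

## References

* [LooijengaLunts1997] E. Looijenga, V. A. Lunts, *A Lie algebra attached to a projective variety*, Invent. Math.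
  129 (1997) 361–412; arXiv:alg-geom/9604014. §1 (1.6) proof p. 6 L10–L12 of the held TeX text; (1.14) p. 7 L106–L108;
  (1.15) p. 8; (1.16) p. 8 L85.
* [Andre1996Motifs] Y. André, *Pour une théorie inconditionnelle des motifs*, Publ. Math. IHÉS 83 (1996) 5–49, §1.1
  ("la décomposition de Lefschetz") — via `LefschetzModuleStringReversal.lean`.
-/

noncomputable section

namespace Literature.Algebra.Lie

open Module Function Set
open HasLefschetzProperty (primitiveSpace mem_primitiveSpace_iff)

-- No Lie bracket is needed in this file (linear algebra of the string coordinates only), so the series' file-local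
-- `LieRing.ofAssociativeRing` instance is NOT enabled here.

variable {K : Type*} [Field K] [CharZero K] {M : Type*} [AddCommGroup M] [Module K M] [FiniteDimensional K M]
  {h e s : Module.End K M}

namespace HasLefschetzProperty

/-! ### §1 The two maps -/

/-- **The string coordinates, collected**: `x ↦ (C_{k,i} x)_{k < D, i ≤ k}`, `C_{k,i} x ∈ P_{-k}` (A1-128
`stringCoordTo`). [cite: LooijengaLunts1997, §1 (1.6) proof p0006 L10–L12 ("N = ⊕_{k≥0} ℂ[e] P_{-k}(N)")] -/
def stringCoords (L : HasLefschetzProperty h e) (hgr : IsZGrading h) (hs : IsStringReversal h e s) (D : ℕ) :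
    M →ₗ[K] ((k : Fin D) → (Fin (k + 1) → primitiveSpace h e k)) :=
  LinearMap.pi fun k ↦ LinearMap.pi fun i ↦ L.stringCoordTo hgr hs k i

/-- Components of `stringCoords`. [cite: LooijengaLunts1997, §1 (1.6) proof p0006 L10–L12] -/
@[simp] theorem stringCoords_apply (L : HasLefschetzProperty h e) (hgr : IsZGrading h) (hs : IsStringReversal h e s)
    (D : ℕ) (x : M) (k : Fin D) (i : Fin (k + 1)) :
    L.stringCoords hgr hs D x k i = L.stringCoordTo hgr hs k i x := rfl

variable (h e) in
/-- **Assembling strings**: `(p_{k,i})_{k,i} ↦ Σ_k Σ_{i ≤ k} eⁱ p_{k,i}` — the element of `⊕ₖ K[e] P_{-k}` with the given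
components. [cite: LooijengaLunts1997, §1 (1.6) proof p0006 L10–L12 ("⊕_{k≥0} ℂ[e] P_{-k}(N)")] -/
def assembleStrings (D : ℕ) : ((k : Fin D) → (Fin (k + 1) → primitiveSpace h e k)) →ₗ[K] M :=
  ∑ k : Fin D, ∑ i : Fin (k + 1),
    (e ^ (i : ℕ)) ∘ₗ (primitiveSpace h e k).subtype ∘ₗ LinearMap.proj i ∘ₗ LinearMap.proj k

omit [CharZero K] [FiniteDimensional K M] in
/-- Unfolding `assembleStrings`. [cite: LooijengaLunts1997, §1 (1.6) proof p0006 L10–L12] -/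
theorem assembleStrings_apply (D : ℕ) (p : (k : Fin D) → (Fin (k + 1) → primitiveSpace h e k)) :
    assembleStrings h e D p = ∑ k : Fin D, ∑ i : Fin (k + 1), (e ^ (i : ℕ)) (p k i : M) := by
  simp only [assembleStrings, LinearMap.sum_apply, LinearMap.comp_apply, LinearMap.proj_apply,
    Submodule.subtype_apply]

/-! ### §2 They are inverse to each other -/

/-- `Σ_{k,i} eⁱ C_{k,i} x = x` (A1-128 `sum_pow_mul_stringCoord`, re-indexed by `Fin`). [cite: LooijengaLunts1997, §1 (1.6) proof p0006 L10–L12] -/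
theorem assembleStrings_stringCoords (L : HasLefschetzProperty h e) (hgr : IsZGrading h) (hs : IsStringReversal h e s)
    {D : ℕ} (hD : finrank K M ≤ D) (x : M) : assembleStrings h e D (L.stringCoords hgr hs D x) = x := by
  rw [assembleStrings_apply]
  have h1 := LinearMap.congr_fun (L.sum_pow_mul_stringCoord hgr hs hD) x
  rw [Module.End.one_apply, LinearMap.sum_apply] at h1
  conv_rhs => rw [← h1]
  rw [Finset.sum_range (fun k ↦ (∑ i ∈ Finset.range (k + 1), e ^ i * stringCoord e s k i) x)]
  refine Finset.sum_congr rfl fun k _ ↦ ?_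
  rw [LinearMap.sum_apply, Finset.sum_range (fun i ↦ (e ^ i * stringCoord e s k i) x)]
  refine Finset.sum_congr rfl fun i _ ↦ ?_
  rw [Module.End.mul_apply, stringCoords_apply, coe_stringCoordTo_apply]

/-- `C_{k,i}(Σ_{k',i'} e^{i'} p_{k',i'}) = p_{k,i}` (the string coordinates of an assembled vector).
[cite: LooijengaLunts1997, §1 (1.6) proof p0006 L10–L12] -/
theorem stringCoords_assembleStrings (L : HasLefschetzProperty h e) (hgr : IsZGrading h) (hs : IsStringReversal h e s)
    (D : ℕ) (p : (k : Fin D) → (Fin (k + 1) → primitiveSpace h e k)) :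
    L.stringCoords hgr hs D (assembleStrings h e D p) = p := by
  funext k i
  rw [stringCoords_apply, assembleStrings_apply, map_sum,
    Finset.sum_eq_single_of_mem k (Finset.mem_univ k) fun k' _ hk' ↦ ?_, map_sum,
    Finset.sum_eq_single_of_mem i (Finset.mem_univ i) fun i' _ hi' ↦ ?_,
    L.stringCoordTo_apply_pow_primitive_self hgr hs (p k i).2 (Nat.lt_succ_iff.1 i.2)]
  · exact L.stringCoordTo_apply_pow_primitive_of_not hgr hs (p k i').2 (Nat.lt_succ_iff.1 i'.2)
      fun hc ↦ hi' (Fin.ext hc.1)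
  · rw [map_sum]
    exact Finset.sum_eq_zero fun i' _ ↦ L.stringCoordTo_apply_pow_primitive_of_not hgr hs (p k' i').2
      (Nat.lt_succ_iff.1 i'.2) fun hc ↦ hk' (Fin.ext hc.2)

/-- **The primitive decomposition `M ≅ ⊕_{k < D} K[e] P_{-k} ≅ ⊕_{k < D} P_{-k}^{k+1}` as a linear isomorphism**
(`D ≥ dim M`; `K[e] P_{-k} = P_{-k} ⊕ eP_{-k} ⊕ ⋯ ⊕ eᵏP_{-k}`, each `eⁱ : P_{-k} ≅ eⁱP_{-k}`): `x ↦ (C_{k,i} x)`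
with inverse `(p_{k,i}) ↦ Σ eⁱ p_{k,i}`. [cite: LooijengaLunts1997, §1 (1.6) proof p0006 L10–L12 ("the primitive decomposition … N = ⊕_{k≥0} ℂ[e] P_{-k}(N), where P_{-k}(N) := Ker(e^{k+1}|N_{-k})")] [cite: LooijengaLunts1997, §1 (1.16) p0008 L85 ("The 𝔰𝔩(2)-triple (e, h, f) in 𝔤 determines a primitive decomposition of V")] -/
def primitiveDecomposition (L : HasLefschetzProperty h e) (hgr : IsZGrading h) (hs : IsStringReversal h e s) {D : ℕ}
    (hD : finrank K M ≤ D) : M ≃ₗ[K] ((k : Fin D) → (Fin (k + 1) → primitiveSpace h e k)) :=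
  LinearEquiv.ofLinear (L.stringCoords hgr hs D) (assembleStrings h e D)
    (LinearMap.ext fun p ↦ L.stringCoords_assembleStrings hgr hs D p)
    (LinearMap.ext fun x ↦ L.assembleStrings_stringCoords hgr hs hD x)

/-- The decomposition reads off the string coordinates. [cite: LooijengaLunts1997, §1 (1.6) proof p0006 L10–L12] -/
@[simp] theorem primitiveDecomposition_apply (L : HasLefschetzProperty h e) (hgr : IsZGrading h)
    (hs : IsStringReversal h e s) {D : ℕ} (hD : finrank K M ≤ D) (x : M) (k : Fin D) (i : Fin (k + 1)) :
    L.primitiveDecomposition hgr hs hD x k i = L.stringCoordTo hgr hs k i x := rfl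

/-- Its inverse assembles strings. [cite: LooijengaLunts1997, §1 (1.6) proof p0006 L10–L12] -/
theorem primitiveDecomposition_symm_apply (L : HasLefschetzProperty h e) (hgr : IsZGrading h)
    (hs : IsStringReversal h e s) {D : ℕ} (hD : finrank K M ≤ D) (p : (k : Fin D) → (Fin (k + 1) → primitiveSpace h e k)) :
    (L.primitiveDecomposition hgr hs hD).symm p = ∑ k : Fin D, ∑ i : Fin (k + 1), (e ^ (i : ℕ)) (p k i : M) :=
  assembleStrings_apply D p

/-! ### §3 Dimension count: `dim M = Σ_k (k + 1) · dim P_{-k}` -/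

/-- **`dim M = Σ_{k < D} (k + 1) · dim P_{-k}`** for any `D ≥ dim M` — "`M ≅ ⊕ₖ V(k)^{m_k}`" numerically, `m_k = dim P_{-k}`
the multiplicity of `V(k)` and `dim V(k) = k + 1` (the `𝔰𝔩₂`-type of `M`, (1.14)–(1.15)).
[cite: LooijengaLunts1997, §1 (1.6) proof p0006 L10–L12] [cite: LooijengaLunts1997, §1 (1.14) p0007 L106–L108 ("the isomorphism class of M as a representation of this 𝔰𝔩(2)-copy … We call it the 𝔰𝔩(2)-type of M")] -/
theorem finrank_eq_sum_mul_finrank_primitiveSpace (L : HasLefschetzProperty h e) (hgr : IsZGrading h) {D : ℕ}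
    (hD : finrank K M ≤ D) : finrank K M = ∑ k : Fin D, ((k : ℕ) + 1) * finrank K (primitiveSpace h e k) := by
  rw [(L.primitiveDecomposition hgr (L.isStringReversal_lefschetzInvolution hgr) hD).finrank_eq,
    Module.finrank_pi_fintype]
  refine Finset.sum_congr rfl fun k _ ↦ ?_
  rw [Module.finrank_pi_fintype, Finset.sum_const, Finset.card_univ, Fintype.card_fin, smul_eq_mul]

/-- The same with `D = dim M`. [cite: LooijengaLunts1997, §1 (1.6) proof p0006 L10–L12] -/
theorem finrank_eq_sum_mul_finrank_primitiveSpace' (L : HasLefschetzProperty h e) (hgr : IsZGrading h) :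
    finrank K M = ∑ k : Fin (finrank K M), ((k : ℕ) + 1) * finrank K (primitiveSpace h e k) :=
  L.finrank_eq_sum_mul_finrank_primitiveSpace hgr le_rfl

/-- **`M = 0` iff all primitive spaces vanish** (a Lefschetz operator on a non-zero module has a primitive vector).
[cite: LooijengaLunts1997, §1 (1.6) proof p0006 L10–L12] -/
theorem finrank_eq_zero_iff_forall_primitiveSpace (L : HasLefschetzProperty h e) (hgr : IsZGrading h) :
    finrank K M = 0 ↔ ∀ k : ℕ, primitiveSpace h e k = ⊥ := by
  constructor
  · intro h0 k
    rw [← Submodule.finrank_eq_zero]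
    have := Submodule.finrank_le (primitiveSpace h e k)
    omega
  · intro hP
    rw [L.finrank_eq_sum_mul_finrank_primitiveSpace' hgr]
    exact Finset.sum_eq_zero fun k _ ↦ by rw [hP k, finrank_bot, mul_zero]

end HasLefschetzProperty

end Literature.Algebra.Lie
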